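import Summits.QuantumFields.YangMills.Theorems.AllWindowsColdBoxBoxHighLineSmearedFPOperatorExpansion
import Mathlib.LinearAlgebra.CrossProduct

/-!
# TASK T-S5.6a `ActionSandwich`, brick 1: the second-order expansion of ONE plaquette cost in the Pauli chart, with the cubic term isolated

Planner ym-idea-2 g18 (2026-08-29T18:56:41Z, `Cruxes/BoxHighWindowsSU22/TaskS5Step2Defs.lean` = ✓`…Step2Defs`, T-S5.6a, owner w2).
For four chart points `U_i = expPauli a_i` with `‖a_i‖ ≤ t ≤ 1` the plaquette cost `2 − Re tr(U₁U₂U₃⁻¹U₄⁻¹)` is the squared circulation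
`‖a₁ + a₂ − a₃ − a₄‖²` up to an error `3·t·‖a₁+a₂−a₃−a₄‖·Σ‖a_i‖ + 13·t²·Σ‖a_i‖²` — the CUBIC term carries a factor of the circulation (it is
`2(det(s,p₂,p₃) + det(p₁,s,p₄))`, `s = Σ±p_i`), which is what makes T-S5.6a's error RELATIVE (`C·t·H`, not `C·t·H²`) after Cauchy–Schwarz
against the Hodge form.

* `re_trace_quad` — the exact trace polynomial of `(c₁ + X p₁)(c₂ + X p₂)(c₃ − X p₃)(c₄ − X p₄)` (dot products, triple products);
* `abs_dotProduct_le_of`, `abs_triple_le_of` — Cauchy–Schwarz in `ℝ³` and `|x·(y×z)| ≤ |x||y||z|` with length bounds (Lagrange's identity ✓`cross_dot_cross`);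
* `cost_sub_sq_decomp` — the algebraic decomposition of `2 − 2·poly − s·s` (`s = p₁+p₂−p₃−p₄`) into diagonal / cross / cubic / quartic
  groups, the cubic group written as `2(s·(p₂×p₃) + p₁·(s×p₄))` (CIRCULATION-DIVISIBLE) plus `(c_i − 1)`-weighted triple products;
* `abs_diag_le`, `abs_pair_le`, `abs_cubic_le`, `abs_quartic_le` and ★ **`abs_cost_sub_dot_le`** — for `c_i ∈ [1 − t_i²/2, 1]`,
  `p_i·p_i = 1 − c_i²` (i.e. `c_i = cos‖a_i‖`, `p_i = sinc‖a_i‖·a_i`), `0 ≤ t_i ≤ t ≤ 1`: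
  `|2 − 2·poly − s·s| ≤ 2t·|s|·Σt_i + 11t²·Σt_i²`.
NEXT FILE (same seat): the link `↑(expPauli a) = cos‖a‖·1 + X(sinc‖a‖·a)` (✓`coe_expPauli_eq`), `|sinc‖a‖·a|² = 1 − cos²‖a‖`, and
`|s| ≤ ‖a₁+a₂−a₃−a₄‖ + (t²/6)Σ‖a_i‖` (✓`abs_sinc_sub_one_le`) give
`|2 − Re tr(U₁U₂U₃⁻¹U₄⁻¹) − ‖a₁+a₂−a₃−a₄‖²| ≤ 3t‖a₁+a₂−a₃−a₄‖Σ‖a_i‖ + 13t²Σ‖a_i‖²` per plaquette; then the sum over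
`plaquettesTouching` with ✓S1 `stub_hodgePoincare` (Σ‖a_e‖² ≤ (H²/c)·boxQuadForm) and Cauchy–Schwarz gives T-S5.6a's `C·t·H`.

HONEST LABEL: one brick of T-S5.6a (an M support task of STEP 2 of the XL stub S5); S5, U5, ⟨24004⟩ ⟨24335⟩ ⟨24336⟩ remain OPEN; no crux,
rung or summit is proved; the Yang–Mills mass gap is NOT proved by this file.
-/

set_option autoImplicit false

noncomputable section

open Matrix Finset
open Literature.MathematicalPhysics.QuantumFieldTheory.Balaban1983to89.B10Eq18SigmaSU2 (su2Coord)
open Literature.MathematicalPhysics.QuantumFieldTheory.Balaban1983to89.B10Eq18SigmaSU2Haar (expPauli)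

namespace Summit.QuantumFields.YangMills.Theorems.AllWindowsColdBoxBoxHighLine

namespace PlaqCost

/-! ## The exact trace polynomial -/

/-- **The trace of a product of four chart points**, `M_i = c_i·1 ± X(p_i)`:
`½ Re tr[(c₁ + X p₁)(c₂ + X p₂)(c₃ − X p₃)(c₄ − X p₄)]` as a polynomial in the `c_i`, the dot products `p_i·p_j` and the triple products. -/
theorem re_trace_quad (c₁ c₂ c₃ c₄ : ℝ) (p₁ p₂ p₃ p₄ : Fin 3 → ℝ) :
    (((c₁ : ℂ) • (1 : Matrix (Fin 2) (Fin 2) ℂ) + su2Coord p₁) * ((c₂ : ℂ) • 1 + su2Coord p₂) *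
        ((c₃ : ℂ) • 1 - su2Coord p₃) * ((c₄ : ℂ) • 1 - su2Coord p₄)).trace.re =
      2 * (c₁ * c₂ * c₃ * c₄ - c₁ * c₂ * (p₃ ⬝ᵥ p₄) - c₃ * c₄ * (p₁ ⬝ᵥ p₂) + c₁ * c₃ * (p₂ ⬝ᵥ p₄) + c₁ * c₄ * (p₂ ⬝ᵥ p₃)
        + c₂ * c₃ * (p₁ ⬝ᵥ p₄) + c₂ * c₄ * (p₁ ⬝ᵥ p₃) + (p₁ ⬝ᵥ p₂) * (p₃ ⬝ᵥ p₄) - (p₁ ⬝ᵥ p₃) * (p₂ ⬝ᵥ p₄) + (p₁ ⬝ᵥ p₄) * (p₂ ⬝ᵥ p₃)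
        + c₁ * (p₂ ⬝ᵥ (p₃ ⨯₃ p₄)) + c₂ * (p₁ ⬝ᵥ (p₃ ⨯₃ p₄)) - c₃ * (p₁ ⬝ᵥ (p₂ ⨯₃ p₄)) - c₄ * (p₁ ⬝ᵥ (p₂ ⨯₃ p₃))) := by
  simp [Matrix.trace, Matrix.mul_apply, Fin.sum_univ_two, su2Coord, dotProduct, cross_apply, Fin.sum_univ_three,
    Complex.mul_re, Complex.mul_im, Complex.add_re, Complex.add_im, Complex.sub_re, Complex.sub_im]
  ring

/-! ## Cauchy–Schwarz and the triple product in `ℝ³` -/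

/-- Cauchy–Schwarz in `ℝ³` with length bounds: `|x| ≤ a`, `|y| ≤ b` ⇒ `|x·y| ≤ a·b` (`|v| = √(v·v)`). -/
theorem abs_dotProduct_le_of (x y : Fin 3 → ℝ) {a b : ℝ} (hx : Real.sqrt (x ⬝ᵥ x) ≤ a) (hy : Real.sqrt (y ⬝ᵥ y) ≤ b)
    (ha : 0 ≤ a) : |x ⬝ᵥ y| ≤ a * b := by
  have hx0 : 0 ≤ x ⬝ᵥ x := Finset.sum_nonneg fun i _ => mul_self_nonneg _
  have hcs : |x ⬝ᵥ y| ≤ Real.sqrt (x ⬝ᵥ x) * Real.sqrt (y ⬝ᵥ y) := by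
    rw [← Real.sqrt_mul hx0]
    refine Real.abs_le_sqrt ?_
    have h := Finset.sum_mul_sq_le_sq_mul_sq (Finset.univ : Finset (Fin 3)) x y
    simp only [dotProduct, sq] at h ⊢
    exact h
  exact hcs.trans (mul_le_mul hx hy (Real.sqrt_nonneg _) ha)

/-- `|x·(y × z)| ≤ a·(b·c)` for `|x| ≤ a`, `|y| ≤ b`, `|z| ≤ c` (Lagrange's identity ✓`cross_dot_cross`: `|y × z|² ≤ |y|²|z|²`). -/
theorem abs_triple_le_of (x y z : Fin 3 → ℝ) {nx ny nz : ℝ} (hx : Real.sqrt (x ⬝ᵥ x) ≤ nx) (hy : Real.sqrt (y ⬝ᵥ y) ≤ ny)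
    (hz : Real.sqrt (z ⬝ᵥ z) ≤ nz) (hny : 0 ≤ ny) : |x ⬝ᵥ (y ⨯₃ z)| ≤ nx * (ny * nz) := by
  have hy0 : 0 ≤ y ⬝ᵥ y := Finset.sum_nonneg fun i _ => mul_self_nonneg _
  have hlag : (y ⨯₃ z) ⬝ᵥ (y ⨯₃ z) ≤ (y ⬝ᵥ y) * (z ⬝ᵥ z) := by
    rw [cross_dot_cross, dotProduct_comm z y]
    nlinarith [sq_nonneg (y ⬝ᵥ z)]
  have hcr : Real.sqrt ((y ⨯₃ z) ⬝ᵥ (y ⨯₃ z)) ≤ ny * nz := by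
    calc Real.sqrt ((y ⨯₃ z) ⬝ᵥ (y ⨯₃ z)) ≤ Real.sqrt ((y ⬝ᵥ y) * (z ⬝ᵥ z)) := Real.sqrt_le_sqrt hlag
      _ = Real.sqrt (y ⬝ᵥ y) * Real.sqrt (z ⬝ᵥ z) := Real.sqrt_mul hy0 _
      _ ≤ ny * nz := mul_le_mul hy hz (Real.sqrt_nonneg _) hny
  exact abs_dotProduct_le_of x _ hx hcr ((Real.sqrt_nonneg _).trans hx)

/-! ## The estimate for the trace polynomial -/

/-- The cost polynomial `2 − Re tr` of `re_trace_quad`, as a function of the scalars and vectors. -/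
theorem cost_sub_sq_decomp (c₁ c₂ c₃ c₄ : ℝ) (p₁ p₂ p₃ p₄ : Fin 3 → ℝ) :
    (2 - 2 * (c₁ * c₂ * c₃ * c₄ - c₁ * c₂ * (p₃ ⬝ᵥ p₄) - c₃ * c₄ * (p₁ ⬝ᵥ p₂) + c₁ * c₃ * (p₂ ⬝ᵥ p₄) + c₁ * c₄ * (p₂ ⬝ᵥ p₃)
        + c₂ * c₃ * (p₁ ⬝ᵥ p₄) + c₂ * c₄ * (p₁ ⬝ᵥ p₃) + (p₁ ⬝ᵥ p₂) * (p₃ ⬝ᵥ p₄) - (p₁ ⬝ᵥ p₃) * (p₂ ⬝ᵥ p₄) + (p₁ ⬝ᵥ p₄) * (p₂ ⬝ᵥ p₃)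
        + c₁ * (p₂ ⬝ᵥ (p₃ ⨯₃ p₄)) + c₂ * (p₁ ⬝ᵥ (p₃ ⨯₃ p₄)) - c₃ * (p₁ ⬝ᵥ (p₂ ⨯₃ p₄)) - c₄ * (p₁ ⬝ᵥ (p₂ ⨯₃ p₃))))
      - (p₁ + p₂ - p₃ - p₄) ⬝ᵥ (p₁ + p₂ - p₃ - p₄) =
      -- E1: diagonal
      (2 - 2 * (c₁ * c₂ * c₃ * c₄) - (p₁ ⬝ᵥ p₁ + p₂ ⬝ᵥ p₂ + p₃ ⬝ᵥ p₃ + p₄ ⬝ᵥ p₄))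
      -- E2: cross terms
      + (2 * (c₃ * c₄ - 1) * (p₁ ⬝ᵥ p₂) + 2 * (c₁ * c₂ - 1) * (p₃ ⬝ᵥ p₄) - 2 * (c₁ * c₃ - 1) * (p₂ ⬝ᵥ p₄)
          - 2 * (c₁ * c₄ - 1) * (p₂ ⬝ᵥ p₃) - 2 * (c₂ * c₃ - 1) * (p₁ ⬝ᵥ p₄) - 2 * (c₂ * c₄ - 1) * (p₁ ⬝ᵥ p₃))
      -- E3: cubic (circulation-divisible part + `(c − 1)`-part)
      + (2 * ((p₁ + p₂ - p₃ - p₄) ⬝ᵥ (p₂ ⨯₃ p₃) + p₁ ⬝ᵥ ((p₁ + p₂ - p₃ - p₄) ⨯₃ p₄))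
          - 2 * ((c₁ - 1) * (p₂ ⬝ᵥ (p₃ ⨯₃ p₄)) + (c₂ - 1) * (p₁ ⬝ᵥ (p₃ ⨯₃ p₄)) - (c₃ - 1) * (p₁ ⬝ᵥ (p₂ ⨯₃ p₄))
              - (c₄ - 1) * (p₁ ⬝ᵥ (p₂ ⨯₃ p₃))))
      -- E4: quartic
      + (-2 * ((p₁ ⬝ᵥ p₂) * (p₃ ⬝ᵥ p₄)) + 2 * ((p₁ ⬝ᵥ p₃) * (p₂ ⬝ᵥ p₄)) - 2 * ((p₁ ⬝ᵥ p₄) * (p₂ ⬝ᵥ p₃))) := by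
  simp only [dotProduct, cross_apply, Fin.sum_univ_three, Pi.add_apply, Pi.sub_apply, Matrix.cons_val_zero, Matrix.cons_val_one,
    Matrix.cons_val_two, Matrix.head_cons, Matrix.tail_cons]
  ring

/-! ### Scalar bookkeeping for the four error groups -/

/-- Length of a chart vector: `p·p = 1 − c²`, `1 − t²/2 ≤ c ≤ 1` ⇒ `|p| ≤ t`. -/
theorem sqrt_dot_le_of {c ti : ℝ} {p : Fin 3 → ℝ} (hti : 0 ≤ ti) (hc : 1 - ti ^ 2 / 2 ≤ c) (hc1 : c ≤ 1)
    (hp : p ⬝ᵥ p = 1 - c ^ 2) : Real.sqrt (p ⬝ᵥ p) ≤ ti := by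
  rw [hp]
  have h1 : 0 ≤ 1 - c := by linarith
  have h2 : (1 - c) * (1 + c) ≤ (1 - c) * 2 := mul_le_mul_of_nonneg_left (by linarith) h1
  have h3 : 1 - c ^ 2 ≤ ti ^ 2 := by nlinarith
  calc Real.sqrt (1 - c ^ 2) ≤ Real.sqrt (ti ^ 2) := Real.sqrt_le_sqrt h3
    _ = ti := Real.sqrt_sq hti

/-- `|c − 1| ≤ t²/2` for `1 − t_c²/2 ≤ c ≤ 1`, `t_c² ≤ t²`. -/
theorem abs_sub_one_le_of {c tc t : ℝ} (hc : 1 - tc ^ 2 / 2 ≤ c) (hc1 : c ≤ 1) (htc : tc ^ 2 ≤ t ^ 2) :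
    |c - 1| ≤ t ^ 2 / 2 := by
  rw [abs_sub_comm, abs_of_nonneg (by linarith)]; linarith

/-- E1 (diagonal): `|2 − 2c₁c₂c₃c₄ − Σ(1 − c_i²)| ≤ 3t²·Σt_i²`. -/
theorem abs_diag_le {c₁ c₂ c₃ c₄ t t₁ t₂ t₃ t₄ : ℝ} (htt : t ^ 2 ≤ 1)
    (ht₁ : t₁ ^ 2 ≤ t ^ 2) (ht₂ : t₂ ^ 2 ≤ t ^ 2) (ht₃ : t₃ ^ 2 ≤ t ^ 2) (ht₄ : t₄ ^ 2 ≤ t ^ 2)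
    (hc₁ : 1 - t₁ ^ 2 / 2 ≤ c₁) (hc₂ : 1 - t₂ ^ 2 / 2 ≤ c₂) (hc₃ : 1 - t₃ ^ 2 / 2 ≤ c₃) (hc₄ : 1 - t₄ ^ 2 / 2 ≤ c₄)
    (hc₁1 : c₁ ≤ 1) (hc₂1 : c₂ ≤ 1) (hc₃1 : c₃ ≤ 1) (hc₄1 : c₄ ≤ 1) :
    |2 - 2 * (c₁ * c₂ * c₃ * c₄) - (1 - c₁ ^ 2 + (1 - c₂ ^ 2) + (1 - c₃ ^ 2) + (1 - c₄ ^ 2))| ≤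
      3 * t ^ 2 * (t₁ ^ 2 + t₂ ^ 2 + t₃ ^ 2 + t₄ ^ 2) := by
  have hd₁ : 0 ≤ 1 - c₁ := by linarith
  have hd₂ : 0 ≤ 1 - c₂ := by linarith
  have hd₃ : 0 ≤ 1 - c₃ := by linarith
  have hd₄ : 0 ≤ 1 - c₄ := by linarith
  have hid : 2 - 2 * (c₁ * c₂ * c₃ * c₄) - (1 - c₁ ^ 2 + (1 - c₂ ^ 2) + (1 - c₃ ^ 2) + (1 - c₄ ^ 2)) =
      ((1 - c₁) * (1 - c₁) + (1 - c₂) * (1 - c₂) + (1 - c₃) * (1 - c₃) + (1 - c₄) * (1 - c₄))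
      - 2 * ((1 - c₁) * (1 - c₂) + (1 - c₁) * (1 - c₃) + (1 - c₁) * (1 - c₄) + (1 - c₂) * (1 - c₃) + (1 - c₂) * (1 - c₄)
          + (1 - c₃) * (1 - c₄))
      + 2 * ((1 - c₁) * ((1 - c₂) * (1 - c₃)) + (1 - c₁) * ((1 - c₂) * (1 - c₄)) + (1 - c₁) * ((1 - c₃) * (1 - c₄))
          + (1 - c₂) * ((1 - c₃) * (1 - c₄)))
      - 2 * ((1 - c₁) * ((1 - c₂) * ((1 - c₃) * (1 - c₄)))) := by ring
  rw [hid]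
  have e₁ : 1 - c₁ ≤ t₁ ^ 2 / 2 := by linarith
  have e₂ : 1 - c₂ ≤ t₂ ^ 2 / 2 := by linarith
  have e₃ : 1 - c₃ ≤ t₃ ^ 2 / 2 := by linarith
  have e₄ : 1 - c₄ ≤ t₄ ^ 2 / 2 := by linarith
  have f₁ : 1 - c₁ ≤ t ^ 2 / 2 := by linarith
  have f₂ : 1 - c₂ ≤ t ^ 2 / 2 := by linarith
  have f₃ : 1 - c₃ ≤ t ^ 2 / 2 := by linarith
  have q : ∀ {x y a : ℝ}, x ≤ t ^ 2 / 2 → 0 ≤ y → y ≤ a → x * y ≤ t ^ 2 / 2 * a :=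
    fun hxt hy hya => mul_le_mul hxt hya hy (by positivity)
  have q₁₁ := q f₁ hd₁ e₁
  have q₂₂ := q f₂ hd₂ e₂
  have q₃₃ := q f₃ hd₃ e₃
  have q₄₄ := q (by linarith : 1 - c₄ ≤ t ^ 2 / 2) hd₄ e₄
  have q₁₂ := q f₁ hd₂ e₂
  have q₁₃ := q f₁ hd₃ e₃
  have q₁₄ := q f₁ hd₄ e₄
  have q₂₃ := q f₂ hd₃ e₃
  have q₂₄ := q f₂ hd₄ e₄
  have q₃₄ := q f₃ hd₄ e₄
  have hh₁ : 1 - c₁ ≤ 1 / 2 := f₁.trans (by linarith)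
  have hh₂ : 1 - c₂ ≤ 1 / 2 := f₂.trans (by linarith)
  have r : ∀ {x y : ℝ} {b : ℝ}, x ≤ 1 / 2 → 0 ≤ y → y ≤ b → x * y ≤ 1 / 2 * b :=
    fun hx1 hy hyb => mul_le_mul hx1 hyb hy (by norm_num)
  have p₂₃ := mul_nonneg hd₂ hd₃
  have p₂₄ := mul_nonneg hd₂ hd₄
  have p₃₄ := mul_nonneg hd₃ hd₄
  have r₁₂₃ : (1 - c₁) * ((1 - c₂) * (1 - c₃)) ≤ 1 / 2 * (t ^ 2 / 2 * (t₃ ^ 2 / 2)) := r hh₁ p₂₃ q₂₃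
  have r₁₂₄ : (1 - c₁) * ((1 - c₂) * (1 - c₄)) ≤ 1 / 2 * (t ^ 2 / 2 * (t₄ ^ 2 / 2)) := r hh₁ p₂₄ q₂₄
  have r₁₃₄ : (1 - c₁) * ((1 - c₃) * (1 - c₄)) ≤ 1 / 2 * (t ^ 2 / 2 * (t₄ ^ 2 / 2)) := r hh₁ p₃₄ q₃₄
  have r₂₃₄ : (1 - c₂) * ((1 - c₃) * (1 - c₄)) ≤ 1 / 2 * (t ^ 2 / 2 * (t₄ ^ 2 / 2)) := r hh₂ p₃₄ q₃₄
  have r₄ : (1 - c₁) * ((1 - c₂) * ((1 - c₃) * (1 - c₄))) ≤ 1 / 2 * (1 / 2 * (t ^ 2 / 2 * (t₄ ^ 2 / 2))) :=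
    r hh₁ (mul_nonneg hd₂ p₃₄) r₂₃₄
  have p₁₂ := mul_nonneg hd₁ hd₂
  have p₁₃ := mul_nonneg hd₁ hd₃
  have p₁₄ := mul_nonneg hd₁ hd₄
  have p3a : 0 ≤ (1 - c₁) * ((1 - c₂) * (1 - c₃)) := mul_nonneg hd₁ p₂₃
  have p3b : 0 ≤ (1 - c₁) * ((1 - c₂) * (1 - c₄)) := mul_nonneg hd₁ p₂₄
  have p3c : 0 ≤ (1 - c₁) * ((1 - c₃) * (1 - c₄)) := mul_nonneg hd₁ p₃₄
  have p3d : 0 ≤ (1 - c₂) * ((1 - c₃) * (1 - c₄)) := mul_nonneg hd₂ p₃₄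
  have p4 : 0 ≤ (1 - c₁) * ((1 - c₂) * ((1 - c₃) * (1 - c₄))) := mul_nonneg hd₁ (mul_nonneg hd₂ p₃₄)
  have hsq₁ := mul_nonneg hd₁ hd₁
  have hsq₂ := mul_nonneg hd₂ hd₂
  have hsq₃ := mul_nonneg hd₃ hd₃
  have hsq₄ := mul_nonneg hd₄ hd₄
  have ht2 : 0 ≤ t ^ 2 := sq_nonneg t
  have u₁ : t ^ 2 * t₁ ^ 2 ≥ 0 := by positivity
  have u₂ : t ^ 2 * t₂ ^ 2 ≥ 0 := by positivity
  have u₃ : t ^ 2 * t₃ ^ 2 ≥ 0 := by positivity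
  have u₄ : t ^ 2 * t₄ ^ 2 ≥ 0 := by positivity
  rw [abs_le]
  constructor
  · linarith
  · linarith

/-- E2 (one cross term): `|2(c_kc_l − 1)(p_i·p_j)| ≤ t²(t_i² + t_j²)`. -/
theorem abs_pair_le {ck cl tk tl t ti tj : ℝ} (pi pj : Fin 3 → ℝ) (htt : t ^ 2 ≤ 1)
    (hck : 1 - tk ^ 2 / 2 ≤ ck) (hck1 : ck ≤ 1) (hcl : 1 - tl ^ 2 / 2 ≤ cl) (hcl1 : cl ≤ 1) (htk : tk ^ 2 ≤ t ^ 2)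
    (htl : tl ^ 2 ≤ t ^ 2) (hpi : Real.sqrt (pi ⬝ᵥ pi) ≤ ti) (hpj : Real.sqrt (pj ⬝ᵥ pj) ≤ tj) (hti : 0 ≤ ti) :
    |2 * (ck * cl - 1) * (pi ⬝ᵥ pj)| ≤ t ^ 2 * (ti ^ 2 + tj ^ 2) := by
  have hcl0 : 0 ≤ cl := by linarith
  have hprod : ck * cl ≤ 1 := mul_le_one₀ hck1 hcl0 hcl1
  have h1 : |ck * cl - 1| ≤ t ^ 2 := by
    rw [abs_sub_comm, abs_of_nonneg (by linarith)]
    nlinarith [mul_nonneg (sub_nonneg.2 hck1) (sub_nonneg.2 hcl1)]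
  have h2 : |pi ⬝ᵥ pj| ≤ ti * tj := abs_dotProduct_le_of pi pj hpi hpj hti
  rw [abs_mul, abs_mul, abs_two]
  have h3 : 2 * |ck * cl - 1| * |pi ⬝ᵥ pj| ≤ 2 * t ^ 2 * (ti * tj) := by
    have := mul_le_mul h1 h2 (abs_nonneg _) (by positivity)
    linarith
  have h4 : 2 * (t ^ 2 * (ti * tj)) ≤ t ^ 2 * (ti ^ 2 + tj ^ 2) := by
    have := mul_nonneg (sq_nonneg t) (sq_nonneg (ti - tj))
    nlinarith
  linarith

/-- `t_i·t_j·t_k ≤ (t_j² + t_k²)/2` when `t_i ≤ 1`. -/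
theorem mul_mul_le_half_sq {ti tj tk : ℝ} (hti : ti ≤ 1) (htj : 0 ≤ tj) (htk : 0 ≤ tk) : ti * (tj * tk) ≤ (tj ^ 2 + tk ^ 2) / 2 := by
  have := mul_nonneg htj htk
  nlinarith [sq_nonneg (tj - tk)]

/-- E3 (cubic): the circulation-divisible part and the `(c − 1)` part. -/
theorem abs_cubic_le (c₁ c₂ c₃ c₄ : ℝ) (p₁ p₂ p₃ p₄ : Fin 3 → ℝ) {t t₁ t₂ t₃ t₄ : ℝ} (ht : t ≤ 1) (ht0 : 0 ≤ t)
    (h₁ : t₁ ≤ t) (h₂ : t₂ ≤ t) (h₄ : t₄ ≤ t) (h₁0 : 0 ≤ t₁) (h₂0 : 0 ≤ t₂) (h₃0 : 0 ≤ t₃) (h₄0 : 0 ≤ t₄)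
    (ht₁ : t₁ ^ 2 ≤ t ^ 2) (ht₂ : t₂ ^ 2 ≤ t ^ 2) (ht₃ : t₃ ^ 2 ≤ t ^ 2) (ht₄ : t₄ ^ 2 ≤ t ^ 2)
    (hc₁ : 1 - t₁ ^ 2 / 2 ≤ c₁) (hc₂ : 1 - t₂ ^ 2 / 2 ≤ c₂) (hc₃ : 1 - t₃ ^ 2 / 2 ≤ c₃) (hc₄ : 1 - t₄ ^ 2 / 2 ≤ c₄)
    (hc₁1 : c₁ ≤ 1) (hc₂1 : c₂ ≤ 1) (hc₃1 : c₃ ≤ 1) (hc₄1 : c₄ ≤ 1)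
    (n₁ : Real.sqrt (p₁ ⬝ᵥ p₁) ≤ t₁) (n₂ : Real.sqrt (p₂ ⬝ᵥ p₂) ≤ t₂) (n₃ : Real.sqrt (p₃ ⬝ᵥ p₃) ≤ t₃)
    (n₄ : Real.sqrt (p₄ ⬝ᵥ p₄) ≤ t₄) :
    |2 * ((p₁ + p₂ - p₃ - p₄) ⬝ᵥ (p₂ ⨯₃ p₃) + p₁ ⬝ᵥ ((p₁ + p₂ - p₃ - p₄) ⨯₃ p₄))
      - 2 * ((c₁ - 1) * (p₂ ⬝ᵥ (p₃ ⨯₃ p₄)) + (c₂ - 1) * (p₁ ⬝ᵥ (p₃ ⨯₃ p₄)) - (c₃ - 1) * (p₁ ⬝ᵥ (p₂ ⨯₃ p₄))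
          - (c₄ - 1) * (p₁ ⬝ᵥ (p₂ ⨯₃ p₃)))| ≤
      2 * t * Real.sqrt ((p₁ + p₂ - p₃ - p₄) ⬝ᵥ (p₁ + p₂ - p₃ - p₄)) * (t₁ + t₂ + t₃ + t₄)
        + 2 * t ^ 2 * (t₁ ^ 2 + t₂ ^ 2 + t₃ ^ 2 + t₄ ^ 2) := by
  have hS0 : 0 ≤ Real.sqrt ((p₁ + p₂ - p₃ - p₄) ⬝ᵥ (p₁ + p₂ - p₃ - p₄)) := Real.sqrt_nonneg _
  have b1 : |(p₁ + p₂ - p₃ - p₄) ⬝ᵥ (p₂ ⨯₃ p₃)| ≤ Real.sqrt ((p₁ + p₂ - p₃ - p₄) ⬝ᵥ (p₁ + p₂ - p₃ - p₄)) * (t * t₃) :=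
    (abs_triple_le_of (p₁ + p₂ - p₃ - p₄) p₂ p₃ le_rfl n₂ n₃ h₂0).trans
      (mul_le_mul_of_nonneg_left (mul_le_mul_of_nonneg_right h₂ h₃0) hS0)
  have b2 : |p₁ ⬝ᵥ ((p₁ + p₂ - p₃ - p₄) ⨯₃ p₄)| ≤ t * (Real.sqrt ((p₁ + p₂ - p₃ - p₄) ⬝ᵥ (p₁ + p₂ - p₃ - p₄)) * t₁) := by
    refine (abs_triple_le_of p₁ _ p₄ n₁ le_rfl n₄ hS0).trans ?_
    have : t₁ * (Real.sqrt ((p₁ + p₂ - p₃ - p₄) ⬝ᵥ (p₁ + p₂ - p₃ - p₄)) * t₄) ≤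
        t₁ * (Real.sqrt ((p₁ + p₂ - p₃ - p₄) ⬝ᵥ (p₁ + p₂ - p₃ - p₄)) * t) :=
      mul_le_mul_of_nonneg_left (mul_le_mul_of_nonneg_left h₄ hS0) h₁0
    linarith
  have ht₁u : t₁ ≤ 1 := h₁.trans ht
  have ht₂u : t₂ ≤ 1 := h₂.trans ht
  have d234 := (abs_triple_le_of p₂ p₃ p₄ n₂ n₃ n₄ h₃0).trans (mul_mul_le_half_sq ht₂u h₃0 h₄0)
  have d134 := (abs_triple_le_of p₁ p₃ p₄ n₁ n₃ n₄ h₃0).trans (mul_mul_le_half_sq ht₁u h₃0 h₄0)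
  have d124 := (abs_triple_le_of p₁ p₂ p₄ n₁ n₂ n₄ h₂0).trans (mul_mul_le_half_sq ht₁u h₂0 h₄0)
  have d123 := (abs_triple_le_of p₁ p₂ p₃ n₁ n₂ n₃ h₂0).trans (mul_mul_le_half_sq ht₁u h₂0 h₃0)
  have g₁ := abs_sub_one_le_of hc₁ hc₁1 ht₁
  have g₂ := abs_sub_one_le_of hc₂ hc₂1 ht₂
  have g₃ := abs_sub_one_le_of hc₃ hc₃1 ht₃
  have g₄ := abs_sub_one_le_of hc₄ hc₄1 ht₄
  have m₁ : |(c₁ - 1) * (p₂ ⬝ᵥ (p₃ ⨯₃ p₄))| ≤ t ^ 2 / 2 * ((t₃ ^ 2 + t₄ ^ 2) / 2) := by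
    rw [abs_mul]; exact mul_le_mul g₁ d234 (abs_nonneg _) (by positivity)
  have m₂ : |(c₂ - 1) * (p₁ ⬝ᵥ (p₃ ⨯₃ p₄))| ≤ t ^ 2 / 2 * ((t₃ ^ 2 + t₄ ^ 2) / 2) := by
    rw [abs_mul]; exact mul_le_mul g₂ d134 (abs_nonneg _) (by positivity)
  have m₃ : |(c₃ - 1) * (p₁ ⬝ᵥ (p₂ ⨯₃ p₄))| ≤ t ^ 2 / 2 * ((t₂ ^ 2 + t₄ ^ 2) / 2) := by
    rw [abs_mul]; exact mul_le_mul g₃ d124 (abs_nonneg _) (by positivity)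
  have m₄ : |(c₄ - 1) * (p₁ ⬝ᵥ (p₂ ⨯₃ p₃))| ≤ t ^ 2 / 2 * ((t₂ ^ 2 + t₃ ^ 2) / 2) := by
    rw [abs_mul]; exact mul_le_mul g₄ d123 (abs_nonneg _) (by positivity)
  have habs : |2 * ((p₁ + p₂ - p₃ - p₄) ⬝ᵥ (p₂ ⨯₃ p₃) + p₁ ⬝ᵥ ((p₁ + p₂ - p₃ - p₄) ⨯₃ p₄))
      - 2 * ((c₁ - 1) * (p₂ ⬝ᵥ (p₃ ⨯₃ p₄)) + (c₂ - 1) * (p₁ ⬝ᵥ (p₃ ⨯₃ p₄)) - (c₃ - 1) * (p₁ ⬝ᵥ (p₂ ⨯₃ p₄))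
          - (c₄ - 1) * (p₁ ⬝ᵥ (p₂ ⨯₃ p₃)))| ≤
      2 * (|(p₁ + p₂ - p₃ - p₄) ⬝ᵥ (p₂ ⨯₃ p₃)| + |p₁ ⬝ᵥ ((p₁ + p₂ - p₃ - p₄) ⨯₃ p₄)|)
      + 2 * (|(c₁ - 1) * (p₂ ⬝ᵥ (p₃ ⨯₃ p₄))| + |(c₂ - 1) * (p₁ ⬝ᵥ (p₃ ⨯₃ p₄))| + |(c₃ - 1) * (p₁ ⬝ᵥ (p₂ ⨯₃ p₄))|
          + |(c₄ - 1) * (p₁ ⬝ᵥ (p₂ ⨯₃ p₃))|) := by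
    refine (abs_sub _ _).trans (add_le_add ?_ ?_)
    · rw [abs_mul, abs_two]; exact mul_le_mul_of_nonneg_left (abs_add_le _ _) (by norm_num)
    · rw [abs_mul, abs_two]
      refine mul_le_mul_of_nonneg_left ?_ (by norm_num)
      exact (abs_sub _ _).trans (add_le_add ((abs_sub _ _).trans (add_le_add (abs_add_le _ _) le_rfl)) le_rfl)
  have z₂ : 0 ≤ t * Real.sqrt ((p₁ + p₂ - p₃ - p₄) ⬝ᵥ (p₁ + p₂ - p₃ - p₄)) * t₂ := mul_nonneg (mul_nonneg ht0 hS0) h₂0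
  have z₄ : 0 ≤ t * Real.sqrt ((p₁ + p₂ - p₃ - p₄) ⬝ᵥ (p₁ + p₂ - p₃ - p₄)) * t₄ := mul_nonneg (mul_nonneg ht0 hS0) h₄0
  have w₁ : t ^ 2 * t₁ ^ 2 ≥ 0 := by positivity
  have w₂ : t ^ 2 * t₂ ^ 2 ≥ 0 := by positivity
  have w₃ : t ^ 2 * t₃ ^ 2 ≥ 0 := by positivity
  have w₄ : t ^ 2 * t₄ ^ 2 ≥ 0 := by positivity
  have e1 : Real.sqrt ((p₁ + p₂ - p₃ - p₄) ⬝ᵥ (p₁ + p₂ - p₃ - p₄)) * (t * t₃) =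
      t * Real.sqrt ((p₁ + p₂ - p₃ - p₄) ⬝ᵥ (p₁ + p₂ - p₃ - p₄)) * t₃ := by ring
  rw [e1] at b1
  refine habs.trans ?_
  linarith

/-- E4 (quartic): `|−2(p₁·p₂)(p₃·p₄) + 2(p₁·p₃)(p₂·p₄) − 2(p₁·p₄)(p₂·p₃)| ≤ 3t²·Σt_i²`. -/
theorem abs_quartic_le (p₁ p₂ p₃ p₄ : Fin 3 → ℝ) {t t₁ t₂ t₃ t₄ : ℝ}
    (h₁ : t₁ ≤ t) (h₂ : t₂ ≤ t) (h₁0 : 0 ≤ t₁) (h₂0 : 0 ≤ t₂) (h₃0 : 0 ≤ t₃) (h₄0 : 0 ≤ t₄)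
    (n₁ : Real.sqrt (p₁ ⬝ᵥ p₁) ≤ t₁) (n₂ : Real.sqrt (p₂ ⬝ᵥ p₂) ≤ t₂) (n₃ : Real.sqrt (p₃ ⬝ᵥ p₃) ≤ t₃)
    (n₄ : Real.sqrt (p₄ ⬝ᵥ p₄) ≤ t₄) :
    |-2 * ((p₁ ⬝ᵥ p₂) * (p₃ ⬝ᵥ p₄)) + 2 * ((p₁ ⬝ᵥ p₃) * (p₂ ⬝ᵥ p₄)) - 2 * ((p₁ ⬝ᵥ p₄) * (p₂ ⬝ᵥ p₃))| ≤
      3 * t ^ 2 * (t₁ ^ 2 + t₂ ^ 2 + t₃ ^ 2 + t₄ ^ 2) := by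
  have k12 : |p₁ ⬝ᵥ p₂| ≤ t₁ * t₂ := abs_dotProduct_le_of _ _ n₁ n₂ h₁0
  have k34 : |p₃ ⬝ᵥ p₄| ≤ t₃ * t₄ := abs_dotProduct_le_of _ _ n₃ n₄ h₃0
  have k13 : |p₁ ⬝ᵥ p₃| ≤ t₁ * t₃ := abs_dotProduct_le_of _ _ n₁ n₃ h₁0
  have k24 : |p₂ ⬝ᵥ p₄| ≤ t₂ * t₄ := abs_dotProduct_le_of _ _ n₂ n₄ h₂0
  have k14 : |p₁ ⬝ᵥ p₄| ≤ t₁ * t₄ := abs_dotProduct_le_of _ _ n₁ n₄ h₁0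
  have k23 : |p₂ ⬝ᵥ p₃| ≤ t₂ * t₃ := abs_dotProduct_le_of _ _ n₂ n₃ h₂0
  have w : t₁ * t₂ * (t₃ * t₄) ≤ t ^ 2 * ((t₃ ^ 2 + t₄ ^ 2) / 2) := by
    have h12 : t₁ * t₂ ≤ t ^ 2 := by nlinarith [mul_nonneg h₁0 h₂0]
    have h34 : t₃ * t₄ ≤ (t₃ ^ 2 + t₄ ^ 2) / 2 := by nlinarith [sq_nonneg (t₃ - t₄)]
    exact mul_le_mul h12 h34 (mul_nonneg h₃0 h₄0) (sq_nonneg t)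
  have z1 : |(p₁ ⬝ᵥ p₂) * (p₃ ⬝ᵥ p₄)| ≤ t₁ * t₂ * (t₃ * t₄) := by
    rw [abs_mul]; exact mul_le_mul k12 k34 (abs_nonneg _) (by positivity)
  have z2 : |(p₁ ⬝ᵥ p₃) * (p₂ ⬝ᵥ p₄)| ≤ t₁ * t₃ * (t₂ * t₄) := by
    rw [abs_mul]; exact mul_le_mul k13 k24 (abs_nonneg _) (by positivity)
  have z3 : |(p₁ ⬝ᵥ p₄) * (p₂ ⬝ᵥ p₃)| ≤ t₁ * t₄ * (t₂ * t₃) := by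
    rw [abs_mul]; exact mul_le_mul k14 k23 (abs_nonneg _) (by positivity)
  have e : |-2 * ((p₁ ⬝ᵥ p₂) * (p₃ ⬝ᵥ p₄)) + 2 * ((p₁ ⬝ᵥ p₃) * (p₂ ⬝ᵥ p₄)) - 2 * ((p₁ ⬝ᵥ p₄) * (p₂ ⬝ᵥ p₃))| ≤
      2 * |(p₁ ⬝ᵥ p₂) * (p₃ ⬝ᵥ p₄)| + 2 * |(p₁ ⬝ᵥ p₃) * (p₂ ⬝ᵥ p₄)| + 2 * |(p₁ ⬝ᵥ p₄) * (p₂ ⬝ᵥ p₃)| := by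
    refine (abs_sub _ _).trans (add_le_add ((abs_add_le _ _).trans (add_le_add ?_ ?_)) ?_)
    · rw [abs_mul, abs_neg, abs_two]
    · rw [abs_mul, abs_two]
    · rw [abs_mul, abs_two]
  have e' : t₁ * t₃ * (t₂ * t₄) = t₁ * t₂ * (t₃ * t₄) := by ring
  have e'' : t₁ * t₄ * (t₂ * t₃) = t₁ * t₂ * (t₃ * t₄) := by ring
  rw [e'] at z2
  rw [e''] at z3
  have w₁ : t ^ 2 * t₁ ^ 2 ≥ 0 := by positivity
  have w₂ : t ^ 2 * t₂ ^ 2 ≥ 0 := by positivity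
  linarith

/-- **The estimate for the cost polynomial** (pure `ℝ³` analysis): if `0 ≤ t_i ≤ t ≤ 1`, `1 − t_i²/2 ≤ c_i ≤ 1` and `p_i·p_i = 1 − c_i²`, then
with `s = p₁ + p₂ − p₃ − p₄`,
`|2 − 2·poly − s·s| ≤ 2·t·|s|·(t₁+t₂+t₃+t₄) + 11·t²·(t₁²+t₂²+t₃²+t₄²)`. -/
theorem abs_cost_sub_dot_le (c₁ c₂ c₃ c₄ : ℝ) (p₁ p₂ p₃ p₄ : Fin 3 → ℝ) {t t₁ t₂ t₃ t₄ : ℝ} (ht : t ≤ 1)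
    (h₁ : t₁ ≤ t) (h₂ : t₂ ≤ t) (h₃ : t₃ ≤ t) (h₄ : t₄ ≤ t) (h₁0 : 0 ≤ t₁) (h₂0 : 0 ≤ t₂) (h₃0 : 0 ≤ t₃) (h₄0 : 0 ≤ t₄)
    (hc₁ : 1 - t₁ ^ 2 / 2 ≤ c₁) (hc₂ : 1 - t₂ ^ 2 / 2 ≤ c₂) (hc₃ : 1 - t₃ ^ 2 / 2 ≤ c₃) (hc₄ : 1 - t₄ ^ 2 / 2 ≤ c₄)
    (hc₁1 : c₁ ≤ 1) (hc₂1 : c₂ ≤ 1) (hc₃1 : c₃ ≤ 1) (hc₄1 : c₄ ≤ 1)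
    (hp₁ : p₁ ⬝ᵥ p₁ = 1 - c₁ ^ 2) (hp₂ : p₂ ⬝ᵥ p₂ = 1 - c₂ ^ 2) (hp₃ : p₃ ⬝ᵥ p₃ = 1 - c₃ ^ 2) (hp₄ : p₄ ⬝ᵥ p₄ = 1 - c₄ ^ 2) :
    |(2 - 2 * (c₁ * c₂ * c₃ * c₄ - c₁ * c₂ * (p₃ ⬝ᵥ p₄) - c₃ * c₄ * (p₁ ⬝ᵥ p₂) + c₁ * c₃ * (p₂ ⬝ᵥ p₄) + c₁ * c₄ * (p₂ ⬝ᵥ p₃)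
        + c₂ * c₃ * (p₁ ⬝ᵥ p₄) + c₂ * c₄ * (p₁ ⬝ᵥ p₃) + (p₁ ⬝ᵥ p₂) * (p₃ ⬝ᵥ p₄) - (p₁ ⬝ᵥ p₃) * (p₂ ⬝ᵥ p₄) + (p₁ ⬝ᵥ p₄) * (p₂ ⬝ᵥ p₃)
        + c₁ * (p₂ ⬝ᵥ (p₃ ⨯₃ p₄)) + c₂ * (p₁ ⬝ᵥ (p₃ ⨯₃ p₄)) - c₃ * (p₁ ⬝ᵥ (p₂ ⨯₃ p₄)) - c₄ * (p₁ ⬝ᵥ (p₂ ⨯₃ p₃))))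
      - (p₁ + p₂ - p₃ - p₄) ⬝ᵥ (p₁ + p₂ - p₃ - p₄)| ≤
      2 * t * Real.sqrt ((p₁ + p₂ - p₃ - p₄) ⬝ᵥ (p₁ + p₂ - p₃ - p₄)) * (t₁ + t₂ + t₃ + t₄)
        + 11 * t ^ 2 * (t₁ ^ 2 + t₂ ^ 2 + t₃ ^ 2 + t₄ ^ 2) := by
  rw [cost_sub_sq_decomp]
  have ht0 : 0 ≤ t := h₁0.trans h₁
  have n₁ := sqrt_dot_le_of h₁0 hc₁ hc₁1 hp₁
  have n₂ := sqrt_dot_le_of h₂0 hc₂ hc₂1 hp₂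
  have n₃ := sqrt_dot_le_of h₃0 hc₃ hc₃1 hp₃
  have n₄ := sqrt_dot_le_of h₄0 hc₄ hc₄1 hp₄
  have ht₁1 : t₁ ^ 2 ≤ t ^ 2 := pow_le_pow_left₀ h₁0 h₁ 2
  have ht₂1 : t₂ ^ 2 ≤ t ^ 2 := pow_le_pow_left₀ h₂0 h₂ 2
  have ht₃1 : t₃ ^ 2 ≤ t ^ 2 := pow_le_pow_left₀ h₃0 h₃ 2
  have ht₄1 : t₄ ^ 2 ≤ t ^ 2 := pow_le_pow_left₀ h₄0 h₄ 2
  have htt : t ^ 2 ≤ 1 := by nlinarith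
  have hE1 := abs_diag_le htt ht₁1 ht₂1 ht₃1 ht₄1 hc₁ hc₂ hc₃ hc₄ hc₁1 hc₂1 hc₃1 hc₄1
  rw [← hp₁, ← hp₂, ← hp₃, ← hp₄] at hE1
  have a12 := abs_pair_le p₁ p₂ htt hc₃ hc₃1 hc₄ hc₄1 ht₃1 ht₄1 n₁ n₂ h₁0
  have a34 := abs_pair_le p₃ p₄ htt hc₁ hc₁1 hc₂ hc₂1 ht₁1 ht₂1 n₃ n₄ h₃0
  have a24 := abs_pair_le p₂ p₄ htt hc₁ hc₁1 hc₃ hc₃1 ht₁1 ht₃1 n₂ n₄ h₂0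
  have a23 := abs_pair_le p₂ p₃ htt hc₁ hc₁1 hc₄ hc₄1 ht₁1 ht₄1 n₂ n₃ h₂0
  have a14 := abs_pair_le p₁ p₄ htt hc₂ hc₂1 hc₃ hc₃1 ht₂1 ht₃1 n₁ n₄ h₁0
  have a13 := abs_pair_le p₁ p₃ htt hc₂ hc₂1 hc₄ hc₄1 ht₂1 ht₄1 n₁ n₃ h₁0
  have hE2 : |2 * (c₃ * c₄ - 1) * (p₁ ⬝ᵥ p₂) + 2 * (c₁ * c₂ - 1) * (p₃ ⬝ᵥ p₄) - 2 * (c₁ * c₃ - 1) * (p₂ ⬝ᵥ p₄)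
      - 2 * (c₁ * c₄ - 1) * (p₂ ⬝ᵥ p₃) - 2 * (c₂ * c₃ - 1) * (p₁ ⬝ᵥ p₄) - 2 * (c₂ * c₄ - 1) * (p₁ ⬝ᵥ p₃)| ≤
      3 * t ^ 2 * (t₁ ^ 2 + t₂ ^ 2 + t₃ ^ 2 + t₄ ^ 2) := by
    refine (abs_sub _ _).trans ?_
    refine (add_le_add ((abs_sub _ _).trans (add_le_add ((abs_sub _ _).trans (add_le_add ((abs_sub _ _).trans
      (add_le_add ((abs_add_le _ _).trans (add_le_add a12 a34)) a24)) a23)) a14)) a13).trans ?_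
    linarith
  have hE3 := abs_cubic_le c₁ c₂ c₃ c₄ p₁ p₂ p₃ p₄ ht ht0 h₁ h₂ h₄ h₁0 h₂0 h₃0 h₄0 ht₁1 ht₂1 ht₃1 ht₄1 hc₁ hc₂ hc₃ hc₄
    hc₁1 hc₂1 hc₃1 hc₄1 n₁ n₂ n₃ n₄
  have hE4 := abs_quartic_le p₁ p₂ p₃ p₄ h₁ h₂ h₁0 h₂0 h₃0 h₄0 n₁ n₂ n₃ n₄
  calc _ ≤ |2 - 2 * (c₁ * c₂ * c₃ * c₄) - (p₁ ⬝ᵥ p₁ + p₂ ⬝ᵥ p₂ + p₃ ⬝ᵥ p₃ + p₄ ⬝ᵥ p₄)|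
        + |2 * (c₃ * c₄ - 1) * (p₁ ⬝ᵥ p₂) + 2 * (c₁ * c₂ - 1) * (p₃ ⬝ᵥ p₄) - 2 * (c₁ * c₃ - 1) * (p₂ ⬝ᵥ p₄)
            - 2 * (c₁ * c₄ - 1) * (p₂ ⬝ᵥ p₃) - 2 * (c₂ * c₃ - 1) * (p₁ ⬝ᵥ p₄) - 2 * (c₂ * c₄ - 1) * (p₁ ⬝ᵥ p₃)|
        + |2 * ((p₁ + p₂ - p₃ - p₄) ⬝ᵥ (p₂ ⨯₃ p₃) + p₁ ⬝ᵥ ((p₁ + p₂ - p₃ - p₄) ⨯₃ p₄))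
            - 2 * ((c₁ - 1) * (p₂ ⬝ᵥ (p₃ ⨯₃ p₄)) + (c₂ - 1) * (p₁ ⬝ᵥ (p₃ ⨯₃ p₄)) - (c₃ - 1) * (p₁ ⬝ᵥ (p₂ ⨯₃ p₄))
                - (c₄ - 1) * (p₁ ⬝ᵥ (p₂ ⨯₃ p₃)))|
        + |-2 * ((p₁ ⬝ᵥ p₂) * (p₃ ⬝ᵥ p₄)) + 2 * ((p₁ ⬝ᵥ p₃) * (p₂ ⬝ᵥ p₄)) - 2 * ((p₁ ⬝ᵥ p₄) * (p₂ ⬝ᵥ p₃))| :=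
        (abs_add_le _ _).trans (add_le_add ((abs_add_le _ _).trans (add_le_add (abs_add_le _ _) le_rfl)) le_rfl)
    _ ≤ _ := by linarith [hE1, hE2, hE3, hE4]

end PlaqCost

end Summit.QuantumFields.YangMills.Theorems.AllWindowsColdBoxBoxHighLine

end
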